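import Literature.MathematicalPhysics.QuantumLattice.ContinuumLimitLGT
import HarnessLib

/-!
# Infinite-volume limits of torus Wilson states are DLR states (proofs)

Sibling proof file of `Literature/MathematicalPhysics/QuantumLattice/LatticeGaugeDLR.lean`
(next to `LatticeGaugeDLRProofs.lean`, gauge covariance, and
`LatticeGaugeDLRLimitPointsProofs.lean`, existence of limit points). It discharges the named fact
`Literature.MathematicalPhysics.QuantumLattice.mem_ymGibbsMeasures_of_mem_infiniteVolumeLimitPoints`
as `mem_ymGibbsMeasures_of_mem_infiniteVolumeLimitPoints_holds`: every subsequential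
infinite-volume limit `μ` of the torus Wilson states `μ_{Λ_{L_k+1}, β}` of lattice gauge theory
with a continuous matrix representation `ρ` of a compact (Hausdorff, second countable) group `G`
satisfies the DLR equations for the lattice Yang–Mills specification `ymSpecification ρ β`
(Seiler LNP 159 Ch. 2; Georgii 2011, Thm. 4.17; Friedli–Velenik 2017, Thm. 6.26 and the remark
on periodic boundary conditions before Exercise 6.14). No definition and no new named fact is
introduced (D-0026); every intermediate result is proved here. The import of
`ContinuumLimitLGT` supplies `continuous_plaquetteObs` (and, through `WilsonLoops`,
`torusProj_add_single`).

## Architecture of the proof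

1. **Resampling identity** (`map_piecewise_prod_pi`, `integral_integral_piecewise`): under the
   product probability measure `ν^ι ⊗ ν^ι` the configuration taking its `Λ`-coordinates from the
   first factor and the others from the second is `ν^ι`-distributed; and reindexing along an
   injection preserves product measures (`pi_map_comp_injective`).
2. **Finite-volume DLR identity in resampling form**
   (`integral_exp_mul_eq_integral_exp_mul_condAvg`): if the energy splits as `a + b` with `b`
   insensitive to the coordinates in `Λ`, then `∫ e^{a+b} F = ∫ e^{a+b} (γ F)` with
   `γ F = (∫ F e^{a} dW_Λ) / (∫ e^{a} dW_Λ)` the Gibbs conditional average over `Λ`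
   (Georgii 2011, Prop. 2.5; Friedli–Velenik 2017, Lemma 6.7).
3. **Torus ↔ `ℤ^d` bookkeeping** (`exists_injOn_torusProj`, `injOn_projPlaquette`,
   `sum_image_proj_plaquetteTerm`, `plaquetteHolonomy_piecewise_of_ne`,
   `torusLift_piecewise_apply`): for `L` large the plaquettes touching `Λ` inject into the torus,
   the torus Wilson action splits into the boundary Wilson action `S_Λ ∘ torusLift` plus a far
   part not feeling the edges over `Λ`, and lifting a resampled torus configuration is gluing.
4. **The kernels** (`integral_ymSpecification`, `isProbabilityMeasure_ymSpecification`,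
   `continuous_integral_ymSpecification` = Feller property, `dependsOn_integral_ymSpecification`
   = quasilocality/finite range, `measurable_ymSpecification_apply`).
5. **Torus states satisfy the local DLR equations** (`wilsonExpectation_toTorusObservable_eq`)
   and the **assembly** (`mem_ymGibbsMeasures_of_mem_infiniteVolumeLimitPoints_holds`): pass to
   the limit for cylinder observables, extend to bounded continuous observables by dominated
   convergence along cylinder approximations (`exists_piecewise_tendsto`), and conclude
   `μ γ_Λ = μ` by `ext_of_forall_lintegral_eq_of_IsFiniteMeasure` on the compact metrisable
   configuration space.

## References

* H.-O. Georgii, *Gibbs Measures and Phase Transitions*, 2nd ed. (de Gruyter 2011), Def. 2.9,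
  Prop. 2.5, Thm. 4.17 (limits of finite-volume Gibbs distributions of a quasilocal
  specification are Gibbs measures).
* S. Friedli, Y. Velenik, *Statistical Mechanics of Lattice Systems* (CUP 2017), Lemma 6.7,
  Lemma 6.22, Def. 6.25, Thm. 6.26, Lemma 6.28, Exercise 6.14 (periodic/free b.c.).
* E. Seiler, LNP 159 (Springer 1982), Ch. 2 (infinite-volume limit and DLR equations for
  lattice gauge theories).
-/

noncomputable section

open MeasureTheory Filter Topology Finset
open Literature.Probability.LatticeModels

namespace Literature.MathematicalPhysics.QuantumLattice

/-! ### General measure-theoretic helpers -/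

section General

/-- A continuous real function on a compact space is bounded. [folklore] -/
theorem exists_bound_of_continuous {X : Type*} [TopologicalSpace X] [CompactSpace X]
    {f : X → ℝ} (hf : Continuous f) : ∃ C, ∀ x, |f x| ≤ C := by
  obtain ⟨C, hC⟩ := isCompact_univ.exists_bound_of_continuousOn hf.continuousOn
  exact ⟨C, fun x => by simpa [Real.norm_eq_abs] using hC x (Set.mem_univ x)⟩

/-- A bounded a.e.-strongly measurable function is integrable for a finite measure. [folklore] -/
theorem integrable_of_bound {X : Type*} [MeasurableSpace X] {μ : Measure X} [IsFiniteMeasure μ]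
    {f : X → ℝ} (hf : AEStronglyMeasurable f μ) {C : ℝ} (hC : ∀ x, |f x| ≤ C) :
    Integrable f μ :=
  Integrable.mono' (integrable_const C) hf (ae_of_all _ fun x => by
    simpa [Real.norm_eq_abs] using hC x)

/-- Continuity of a parametric integral with a uniformly bounded, separately continuous
integrand over a finite measure (dominated convergence). [folklore] -/
theorem continuous_integral_of_bound {X Y : Type*} [TopologicalSpace X]
    [FirstCountableTopology X] [TopologicalSpace Y] [MeasurableSpace Y] [OpensMeasurableSpace Y]
    {μ : Measure Y} [IsFiniteMeasure μ] {Φ : X → Y → ℝ} (h1 : ∀ x, Continuous (Φ x))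
    (h2 : ∀ y, Continuous fun x => Φ x y) {C : ℝ} (hC : ∀ x y, |Φ x y| ≤ C) :
    Continuous fun x => ∫ y, Φ x y ∂μ :=
  continuous_of_dominated (fun x => (h1 x).aestronglyMeasurable)
    (fun x => ae_of_all _ fun y => by simpa [Real.norm_eq_abs] using hC x y)
    (integrable_const C) (ae_of_all _ fun y => h2 y)

variable {ι : Type*} [DecidableEq ι] {S : Type*} [MeasurableSpace S]

/-- `p ↦ Λ.piecewise p.1 p.2` is measurable on `(ι → S) × (ι → S)`. [folklore] -/
@[fun_prop]
theorem measurable_piecewise_prod (Λ : Finset ι) :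
    Measurable fun p : (ι → S) × (ι → S) => Λ.piecewise p.1 p.2 := by
  refine measurable_pi_iff.2 fun i => ?_
  by_cases hi : i ∈ Λ
  · simp only [Finset.piecewise_eq_of_mem _ _ _ hi]
    exact (measurable_pi_apply i).comp measurable_fst
  · simp only [Finset.piecewise_eq_of_notMem _ _ _ hi]
    exact (measurable_pi_apply i).comp measurable_snd

/-- **Resampling identity** for product probability measures: if `(W, V)` is distributed
according to `ν^ι ⊗ ν^ι`, then the configuration taking the coordinates in `Λ` from `W` and the
others from `V` is again `ν^ι`-distributed. [folklore] -/
theorem map_piecewise_prod_pi [Fintype ι] (ν : Measure S) [IsProbabilityMeasure ν] (Λ : Finset ι) :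
    ((Measure.pi fun _ : ι => ν).prod (Measure.pi fun _ : ι => ν)).map
        (fun p => Λ.piecewise p.1 p.2) = Measure.pi fun _ : ι => ν := by
  symm
  refine Measure.pi_eq fun s hs => ?_
  rw [Measure.map_apply (measurable_piecewise_prod Λ) (MeasurableSet.univ_pi hs)]
  have hpre : (fun p : (ι → S) × (ι → S) => Λ.piecewise p.1 p.2) ⁻¹' Set.univ.pi s =
      ((↑Λ : Set ι).pi s) ×ˢ (((↑Λ : Set ι)ᶜ).pi s) := by
    ext p
    simp only [Set.mem_preimage, Set.mem_prod, Set.mem_pi, Finset.mem_coe, Set.mem_compl_iff]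
    constructor
    · intro h
      refine ⟨fun i hi => ?_, fun i hi => ?_⟩
      · simpa [Finset.piecewise_eq_of_mem _ _ _ hi] using h i
      · simpa [Finset.piecewise_eq_of_notMem _ _ _ hi] using h i
    · rintro ⟨h₁, h₂⟩ i
      by_cases hi : i ∈ Λ
      · simpa [Finset.piecewise_eq_of_mem _ _ _ hi] using h₁ i hi
      · simpa [Finset.piecewise_eq_of_notMem _ _ _ hi] using h₂ i hi
  have hpi : ∀ (T : Set ι) [DecidablePred (· ∈ T)],
      Measure.pi (fun _ : ι => ν) (T.pi s) = ∏ i, if i ∈ T then ν (s i) else 1 := by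
    intro T _
    rw [← Set.univ_pi_ite T s, Measure.pi_pi]
    refine Finset.prod_congr rfl fun i _ => ?_
    split_ifs <;> simp
  have key : ∀ T : Finset ι,
      (∏ i, if i ∈ (↑T : Set ι) then ν (s i) else 1) = ∏ i ∈ T, ν (s i) := by
    intro T
    rw [← Finset.prod_filter]
    refine Finset.prod_congr ?_ fun _ _ => rfl
    ext i
    simp
  rw [hpre, Measure.prod_prod, ← Finset.coe_compl, hpi, hpi, key, key,
    Finset.prod_mul_prod_compl]

/-- Integral form of the resampling identity `map_piecewise_prod_pi`: for `h` integrable,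
`∫∫ h (Λ.piecewise W V) dν^ι(W) dν^ι(V) = ∫ h dν^ι`. [folklore] -/
theorem integral_integral_piecewise [Fintype ι] (ν : Measure S) [IsProbabilityMeasure ν] (Λ : Finset ι)
    {h : (ι → S) → ℝ} (hh : Integrable h (Measure.pi fun _ : ι => ν)) :
    ∫ V, ∫ W, h (Λ.piecewise W V) ∂(Measure.pi fun _ : ι => ν) ∂(Measure.pi fun _ : ι => ν) =
      ∫ U, h U ∂(Measure.pi fun _ : ι => ν) := by
  have hmap := map_piecewise_prod_pi ν Λ
  have hint : Integrable (fun p : (ι → S) × (ι → S) => h (Λ.piecewise p.1 p.2))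
      ((Measure.pi fun _ : ι => ν).prod (Measure.pi fun _ : ι => ν)) := by
    rw [← hmap] at hh
    exact hh.comp_measurable (measurable_piecewise_prod Λ)
  calc ∫ V, ∫ W, h (Λ.piecewise W V) ∂(Measure.pi fun _ : ι => ν) ∂(Measure.pi fun _ : ι => ν)
      = ∫ p : (ι → S) × (ι → S), h (Λ.piecewise p.1 p.2)
          ∂((Measure.pi fun _ : ι => ν).prod (Measure.pi fun _ : ι => ν)) := by
        rw [integral_prod_symm _ hint]
    _ = ∫ U, h U ∂((Measure.pi fun _ : ι => ν).prod (Measure.pi fun _ : ι => ν)).map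
          (fun p => Λ.piecewise p.1 p.2) := by
        rw [integral_map (measurable_piecewise_prod Λ).aemeasurable]
        rw [hmap]; exact hh.aestronglyMeasurable
    _ = ∫ U, h U ∂(Measure.pi fun _ : ι => ν) := by rw [hmap]

/-- Reindexing a product probability measure along an injection: the coordinates
`(W (τ k))_k` of a `ν^ι`-distributed `W` are `ν^κ`-distributed. [folklore] -/
theorem pi_map_comp_injective [Fintype ι] {κ : Type*} [Fintype κ] (ν : Measure S) [IsProbabilityMeasure ν]
    {τ : κ → ι} (hτ : Function.Injective τ) :
    (Measure.pi fun _ : ι => ν).map (fun W k => W (τ k)) = Measure.pi fun _ : κ => ν := by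
  have hmeas : Measurable fun (W : ι → S) (k : κ) => W (τ k) :=
    measurable_pi_iff.2 fun k => measurable_pi_apply (τ k)
  symm
  refine Measure.pi_eq fun s hs => ?_
  rw [Measure.map_apply hmeas (MeasurableSet.univ_pi hs)]
  classical
  -- the preimage is a box with sides `s (τ⁻¹ i)` over the range of `τ` and `univ` elsewhere
  let t : ι → Set S := fun i => if h : ∃ k, τ k = i then s h.choose else Set.univ
  have hpre : (fun (W : ι → S) (k : κ) => W (τ k)) ⁻¹' Set.univ.pi s = Set.univ.pi t := by
    ext W
    simp only [Set.mem_preimage, Set.mem_univ_pi, t]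
    constructor
    · intro h i
      split_ifs with hi
      · have := h hi.choose
        rwa [hi.choose_spec] at this
      · exact Set.mem_univ _
    · intro h k
      have hk : ∃ k', τ k' = τ k := ⟨k, rfl⟩
      have := h (τ k)
      rw [dif_pos hk, hτ hk.choose_spec] at this
      exact this
  rw [hpre, Measure.pi_pi]
  have : ∏ i, ν (t i) = ∏ i ∈ Finset.univ.image τ, ν (t i) := by
    rw [← Finset.prod_mul_prod_compl (Finset.univ.image τ) fun i => ν (t i)]
    rw [Finset.prod_eq_one (s := (Finset.univ.image τ)ᶜ), mul_one]
    intro i hi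
    have hi' : ¬ ∃ k, τ k = i := by
      rintro ⟨k, rfl⟩
      exact (Finset.mem_compl.1 hi) (Finset.mem_image_of_mem τ (Finset.mem_univ k))
    simp [t, hi']
  rw [this, Finset.prod_image fun k _ k' _ h => hτ h]
  refine Finset.prod_congr rfl fun k _ => ?_
  have hk : ∃ k', τ k' = τ k := ⟨k, rfl⟩
  simp only [t, dif_pos hk]
  rw [hτ hk.choose_spec]

end General

/-! ### Lattice bookkeeping: `ℤ^d` versus the torus `(ℤ/Lℤ)^d` -/

section Lattice

variable {d N : ℕ} {G : Type*} [Group G]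

/-- Reduction mod `L` commutes with a unit step backwards: `proj (x - eᵢ) = proj x - eᵢ`
(from `torusProj_add_single` of `WilsonLoops`). [folklore] -/
theorem torusProj_sub_single_one (L : ℕ) (x : Site d) (i : Fin d) :
    Torus.proj L (x - Pi.single i 1) = Torus.proj L x - Pi.single i 1 := by
  rw [eq_sub_iff_add_eq, ← Int.cast_one (R := ZMod L), ← torusProj_add_single, sub_add_cancel]

/-- For `L` larger than the (sup-norm) diameter of a finite set `B ⊆ ℤ^d`, reduction mod `L`
is injective on `B`. [folklore] -/
theorem exists_injOn_torusProj (B : Finset (Site d)) :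
    ∃ L₀ : ℕ, ∀ L : ℕ, L₀ < L → Set.InjOn (Torus.proj L) (B : Set (Site d)) := by
  refine ⟨B.sup fun x => B.sup fun y => univ.sup fun i => (y i - x i).natAbs, ?_⟩
  intro L hL x hx y hy hxy
  funext i
  have h1 : ((x i : ℤ) : ZMod L) = ((y i : ℤ) : ZMod L) := congr_fun hxy i
  rw [ZMod.intCast_eq_intCast_iff_dvd_sub] at h1
  have h2 : (y i - x i).natAbs < L := by
    refine lt_of_le_of_lt ?_ hL
    exact le_sup_of_le hx (le_sup_of_le hy (le_sup (f := fun i => (y i - x i).natAbs)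
      (mem_univ i)))
  have h3 : |y i - x i| < (L : ℤ) := by
    rw [← Int.natCast_natAbs]; exact_mod_cast h2
  have := Int.eq_zero_of_abs_lt_dvd h1 h3
  omega

/-- `torusEdge L` is injective on a finite edge set as soon as `Torus.proj L` is injective on
its base points. [folklore] -/
theorem injOn_torusEdge {L : ℕ} {T : Finset (ZdEdge d)}
    (hL : Set.InjOn (Torus.proj L) (T.image Prod.fst : Set (Site d))) :
    Set.InjOn (torusEdge (d := d) L) ↑T := by
  intro e₁ h₁ e₂ h₂ h
  simp only [torusEdge, Prod.mk.injEq] at h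
  refine Prod.ext (hL ?_ ?_ h.1) h.2
  · exact mem_coe.2 (mem_image_of_mem _ h₁)
  · exact mem_coe.2 (mem_image_of_mem _ h₂)

/-- Holonomies are compatible with the periodic lift: the torus holonomy at `proj x` equals the
`ℤ^d` holonomy of the lifted configuration at `x`. [folklore] -/
theorem plaquetteHolonomy_torusProj (L : ℕ) (V : QuantumFieldTheory.GaugeConfig d L G)
    (x : Site d) (i j : Fin d) :
    QuantumFieldTheory.plaquetteHolonomy V (Torus.proj L x) i j =
      plaquetteHolonomyZd (torusLift L V) x i j := by
  simp only [QuantumFieldTheory.plaquetteHolonomy, plaquetteHolonomyZd, torusLift,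
    Function.comp_apply, torusEdge, QuantumFieldTheory.Site.shift, torusProj_add_single,
    Int.cast_one]

omit [Group G] in
/-- A torus plaquette `q = (y, i, j)` one of whose four edges `(y, i), (y + eᵢ, j), (y + eⱼ, i),
(y, j)` is the projection of an edge `e ∈ Λ` is the projection of a plaquette of `ℤ^d` touching
`Λ`. [folklore] -/
theorem exists_proj_eq_of_torusEdge_eq {L : ℕ} {Λ : Finset (ZdEdge d)} {e : ZdEdge d} (he : e ∈ Λ)
    (q : QuantumFieldTheory.Plaquette d L)
    (hq : torusEdge L e = (q.1, q.2.1.1) ∨ torusEdge L e = (q.1 + Pi.single q.2.1.1 1, q.2.1.2) ∨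
      torusEdge L e = (q.1 + Pi.single q.2.1.2 1, q.2.1.1) ∨ torusEdge L e = (q.1, q.2.1.2)) :
    ∃ p ∈ plaquettesTouching Λ,
      ((Torus.proj L p.1, p.2) : QuantumFieldTheory.Plaquette d L) = q := by
  obtain ⟨x, k⟩ := e
  obtain ⟨y, ij⟩ := q
  simp only [torusEdge, Prod.mk.injEq] at hq
  rcases hq with ⟨h1, h2⟩ | ⟨h1, h2⟩ | ⟨h1, h2⟩ | ⟨h1, h2⟩
  · refine ⟨(x, ij), mem_plaquettesTouching_iff.2 ⟨(x, k), mem_inter.2 ⟨?_, he⟩⟩, ?_⟩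
    · simp [plaquetteEdges, h2]
    · simp [h1]
  · refine ⟨(x - Pi.single ij.1.1 1, ij),
      mem_plaquettesTouching_iff.2 ⟨(x, k), mem_inter.2 ⟨?_, he⟩⟩, ?_⟩
    · simp [plaquetteEdges, h2]
    · simp [torusProj_sub_single_one, h1]
  · refine ⟨(x - Pi.single ij.1.2 1, ij),
      mem_plaquettesTouching_iff.2 ⟨(x, k), mem_inter.2 ⟨?_, he⟩⟩, ?_⟩
    · simp [plaquetteEdges, h2]
    · simp [torusProj_sub_single_one, h1]
  · refine ⟨(x, ij), mem_plaquettesTouching_iff.2 ⟨(x, k), mem_inter.2 ⟨?_, he⟩⟩, ?_⟩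
    · simp [plaquetteEdges, h2]
    · simp [h1]

omit [Group G] in
/-- Base points of plaquettes touching `Λ` are base points of edges of such plaquettes. [folklore] -/
theorem fst_mem_image_of_mem_plaquettesTouching {Λ : Finset (ZdEdge d)} {p : ZdPlaquette d}
    (hp : p ∈ plaquettesTouching Λ) :
    p.1 ∈ ((plaquettesTouching Λ).biUnion plaquetteEdges).image Prod.fst :=
  mem_image.2 ⟨(p.1, p.2.1.1), mem_biUnion.2 ⟨p, hp, by simp [plaquetteEdges]⟩, rfl⟩

omit [Group G] in
/-- Projection to the torus is injective on the plaquettes touching `Λ` once `Torus.proj L` is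
injective on the base points of their edges. [folklore] -/
theorem injOn_projPlaquette {L : ℕ} {Λ : Finset (ZdEdge d)} {B : Finset (Site d)}
    (hB : ((plaquettesTouching Λ).biUnion plaquetteEdges).image Prod.fst ⊆ B)
    (hL : Set.InjOn (Torus.proj L) (B : Set (Site d))) :
    Set.InjOn (fun p : ZdPlaquette d => ((Torus.proj L p.1, p.2) : QuantumFieldTheory.Plaquette d L))
      ↑(plaquettesTouching Λ) := by
  intro p₁ h₁ p₂ h₂ h
  simp only [Prod.mk.injEq] at h
  refine Prod.ext (hL ?_ ?_ h.1) h.2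
  · exact hB (fst_mem_image_of_mem_plaquettesTouching h₁)
  · exact hB (fst_mem_image_of_mem_plaquettesTouching h₂)

variable (ρ : G →* Matrix (Fin N) (Fin N) ℂ)

/-- **Near part of the torus action.** For `L` large, the torus plaquette terms
`N - Re tr ρ(V_q)` over the projections `q` of the plaquettes touching `Λ` sum to the boundary
Wilson action `S_Λ` of the lifted configuration. [folklore] -/
theorem sum_image_proj_plaquetteTerm {L : ℕ} {Λ : Finset (ZdEdge d)}
    (hinj : Set.InjOn
      (fun p : ZdPlaquette d => ((Torus.proj L p.1, p.2) : QuantumFieldTheory.Plaquette d L))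
      ↑(plaquettesTouching Λ))
    (V : QuantumFieldTheory.GaugeConfig d L G) :
    ∑ q ∈ (plaquettesTouching Λ).image
        (fun p : ZdPlaquette d => ((Torus.proj L p.1, p.2) : QuantumFieldTheory.Plaquette d L)),
      ((N : ℝ) - (ρ (QuantumFieldTheory.plaquetteHolonomy V q.1 q.2.1.1 q.2.1.2)).trace.re) =
      wilsonBoundaryAction ρ Λ (torusLift L V) := by
  classical
  rw [sum_image hinj, wilsonBoundaryAction]
  refine sum_congr rfl fun p _ => ?_
  simp only [plaquetteObs, plaquetteHolonomy_torusProj]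

/-- **Far part of the torus action.** A torus plaquette that is not the projection of a
plaquette touching `Λ` has no edge in `Λ.image (torusEdge L)`, so its holonomy is unchanged
when the edges in `Λ.image (torusEdge L)` are resampled. [folklore] -/
theorem plaquetteHolonomy_piecewise_of_ne {L : ℕ} {Λ : Finset (ZdEdge d)}
    {q : QuantumFieldTheory.Plaquette d L}
    (hq : ∀ p ∈ plaquettesTouching Λ,
      ((Torus.proj L p.1, p.2) : QuantumFieldTheory.Plaquette d L) ≠ q)
    (W V : QuantumFieldTheory.GaugeConfig d L G) :
    QuantumFieldTheory.plaquetteHolonomy ((Λ.image (torusEdge L)).piecewise W V) q.1 q.2.1.1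
        q.2.1.2 = QuantumFieldTheory.plaquetteHolonomy V q.1 q.2.1.1 q.2.1.2 := by
  classical
  have key : ∀ e' : QuantumFieldTheory.Edge d L,
      (e' = (q.1, q.2.1.1) ∨ e' = (q.1 + Pi.single q.2.1.1 1, q.2.1.2) ∨
        e' = (q.1 + Pi.single q.2.1.2 1, q.2.1.1) ∨ e' = (q.1, q.2.1.2)) →
      (Λ.image (torusEdge L)).piecewise W V e' = V e' := fun e' h' =>
    piecewise_eq_of_notMem _ _ _ fun hmem => by
      obtain ⟨e, he, rfl⟩ := mem_image.1 hmem
      obtain ⟨p, hp, hpq⟩ := exists_proj_eq_of_torusEdge_eq he q h'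
      exact hq p hp hpq
  simp only [QuantumFieldTheory.plaquetteHolonomy, QuantumFieldTheory.Site.shift]
  rw [key _ (Or.inl rfl), key _ (Or.inr (Or.inl rfl)), key _ (Or.inr (Or.inr (Or.inl rfl))),
    key _ (Or.inr (Or.inr (Or.inr rfl)))]

omit [Group G] in
/-- **Lift of a resampled torus configuration.** On an edge set `T ⊇ Λ` on which `torusEdge L`
is injective, lifting the torus configuration whose edges in `Λ.image (torusEdge L)` are taken
from `W` agrees with gluing `W ∘ torusEdge L` on `Λ` into the lift of `V`. [folklore] -/
theorem torusLift_piecewise_apply {L : ℕ} {Λ T : Finset (ZdEdge d)} (hΛT : Λ ⊆ T)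
    (hinj : Set.InjOn (torusEdge (d := d) L) ↑T) (W V : QuantumFieldTheory.GaugeConfig d L G)
    {e : ZdEdge d} (he : e ∈ T) :
    torusLift L ((Λ.image (torusEdge L)).piecewise W V) e =
      glueWith Λ (fun e' : ↥Λ => W (torusEdge L e')) (torusLift L V) e := by
  classical
  simp only [torusLift, Function.comp_apply]
  by_cases heΛ : e ∈ Λ
  · rw [piecewise_eq_of_mem _ _ _ (mem_image_of_mem _ heΛ), glueWith_apply_mem _ _ _ heΛ]
  · rw [glueWith_apply_not_mem _ _ _ heΛ, piecewise_eq_of_notMem]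
    · rfl
    · intro hmem
      obtain ⟨e'', he'', h⟩ := mem_image.1 hmem
      exact heΛ (hinj (hΛT he'') he h ▸ he'')

end Lattice

/-! ### The finite-volume DLR identity in resampling form -/

section FiniteDLR

variable {ι : Type*} [Fintype ι] [DecidableEq ι] {S : Type*} [MeasurableSpace S]

/-- **Finite-volume DLR equation (resampling form).** On the finite product `(ι → S, ν^ι)` let
the energy split as a "near" part `a` and a "far" part `b` that does not feel the coordinates in
`Λ`. Then in the Gibbs expectation `∫ e^{a+b} F dν^ι` the observable `F` may be replaced by its
conditional Gibbs average over the coordinates in `Λ`,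
`V ↦ (∫ F(W_Λ V) e^{a(W_Λ V)} dν^ι(W)) / (∫ e^{a(W_Λ V)} dν^ι(W))`, `W_Λ V := Λ.piecewise W V`
(Georgii 2011, Prop. 2.5 / eq. (1.21); Friedli–Velenik 2017, Lemma 6.7). [folklore] -/
theorem integral_exp_mul_eq_integral_exp_mul_condAvg (ν : Measure S) [IsProbabilityMeasure ν]
    (Λ : Finset ι) {F a b NF N1 : (ι → S) → ℝ}
    (hFm : Measurable F) (ham : Measurable a) (hbm : Measurable b)
    {C A B : ℝ} (hFC : ∀ V, |F V| ≤ C) (haA : ∀ V, |a V| ≤ A) (hbB : ∀ V, |b V| ≤ B)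
    (hb : ∀ W V, b (Λ.piecewise W V) = b V)
    (hNF : ∀ V, NF V =
      ∫ W, F (Λ.piecewise W V) * Real.exp (a (Λ.piecewise W V)) ∂(Measure.pi fun _ => ν))
    (hN1 : ∀ V, N1 V = ∫ W, Real.exp (a (Λ.piecewise W V)) ∂(Measure.pi fun _ => ν)) :
    ∫ V, Real.exp (a V + b V) * F V ∂(Measure.pi fun _ => ν) =
      ∫ V, Real.exp (a V + b V) * (NF V / N1 V) ∂(Measure.pi fun _ => ν) := by
  have hpw : Measurable fun p : (ι → S) × (ι → S) => Λ.piecewise p.2 p.1 :=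
    (measurable_piecewise_prod Λ).comp measurable_swap
  -- the integrands defining `NF` and `N1`
  have hΦm : Measurable fun p : (ι → S) × (ι → S) =>
      F (Λ.piecewise p.2 p.1) * Real.exp (a (Λ.piecewise p.2 p.1)) :=
    (hFm.comp hpw).mul (Real.measurable_exp.comp (ham.comp hpw))
  have hΨm : Measurable fun p : (ι → S) × (ι → S) => Real.exp (a (Λ.piecewise p.2 p.1)) :=
    Real.measurable_exp.comp (ham.comp hpw)
  have hNFm : Measurable NF := by
    rw [show NF = fun V => ∫ W, (fun p : (ι → S) × (ι → S) =>
        F (Λ.piecewise p.2 p.1) * Real.exp (a (Λ.piecewise p.2 p.1))) (V, W)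
          ∂(Measure.pi fun _ => ν) from funext hNF]
    exact (hΦm.stronglyMeasurable.integral_prod_right').measurable
  have hN1m : Measurable N1 := by
    rw [show N1 = fun V => ∫ W, (fun p : (ι → S) × (ι → S) =>
        Real.exp (a (Λ.piecewise p.2 p.1))) (V, W) ∂(Measure.pi fun _ => ν) from funext hN1]
    exact (hΨm.stronglyMeasurable.integral_prod_right').measurable
  have hexpa : ∀ U, Real.exp (a U) ≤ Real.exp A := fun U =>
    Real.exp_le_exp.2 ((le_abs_self _).trans (haA U))
  have hintΨ : ∀ V, Integrable (fun W => Real.exp (a (Λ.piecewise W V)))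
      (Measure.pi fun _ => ν) := fun V =>
    integrable_of_bound (Real.measurable_exp.comp
      (ham.comp (hpw.comp measurable_prodMk_left))).aestronglyMeasurable
      (C := Real.exp A) fun W => by
        rw [abs_of_pos (Real.exp_pos _)]; exact hexpa _
  have hN1pos : ∀ V, 0 < N1 V := fun V => by rw [hN1]; exact integral_exp_pos (hintΨ V)
  have hNFle : ∀ V, |NF V| ≤ C * N1 V := fun V => by
    rw [hNF, hN1, ← integral_const_mul, ← Real.norm_eq_abs]
    refine norm_integral_le_of_norm_le ((hintΨ V).const_mul C) (ae_of_all _ fun W => ?_)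
    rw [norm_mul, Real.norm_eq_abs, Real.norm_eq_abs, abs_of_pos (Real.exp_pos _)]
    exact mul_le_mul_of_nonneg_right (hFC _) (Real.exp_pos _).le
  have hquot : ∀ V, |NF V / N1 V| ≤ C := fun V => by
    rw [abs_div, abs_of_pos (hN1pos V), div_le_iff₀ (hN1pos V)]
    exact hNFle V
  -- invariance of `NF`, `N1` under resampling of `Λ`
  have hNFpw : ∀ W V, NF (Λ.piecewise W V) = NF V := fun W V => by
    simp only [hNF, Finset.piecewise_idem_right]
  have hN1pw : ∀ W V, N1 (Λ.piecewise W V) = N1 V := fun W V => by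
    simp only [hN1, Finset.piecewise_idem_right]
  -- integrability of the two outer integrands
  have hexpab : ∀ U, |Real.exp (a U + b U)| ≤ Real.exp (A + B) := fun U => by
    rw [abs_of_pos (Real.exp_pos _), Real.exp_le_exp]
    exact add_le_add ((le_abs_self _).trans (haA U)) ((le_abs_self _).trans (hbB U))
  have hi1 : Integrable (fun V => Real.exp (a V + b V) * F V) (Measure.pi fun _ => ν) :=
    integrable_of_bound ((Real.measurable_exp.comp (ham.add hbm)).mul hFm).aestronglyMeasurable
      (C := Real.exp (A + B) * C) fun V => by
        rw [abs_mul]; exact mul_le_mul (hexpab V) (hFC V) (abs_nonneg _) (Real.exp_pos _).le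
  have hi2 : Integrable (fun V => Real.exp (a V + b V) * (NF V / N1 V)) (Measure.pi fun _ => ν) :=
    integrable_of_bound
      ((Real.measurable_exp.comp (ham.add hbm)).mul (hNFm.div hN1m)).aestronglyMeasurable
      (C := Real.exp (A + B) * C) fun V => by
        rw [abs_mul]; exact mul_le_mul (hexpab V) (hquot V) (abs_nonneg _) (Real.exp_pos _).le
  -- both sides equal `∫ V, exp (b V) * NF V`
  rw [← integral_integral_piecewise ν Λ hi1, ← integral_integral_piecewise ν Λ hi2]
  refine congrArg (fun f : (ι → S) → ℝ => ∫ V, f V ∂(Measure.pi fun _ => ν)) (funext fun V => ?_)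
  have e1 : (fun W => Real.exp (a (Λ.piecewise W V) + b (Λ.piecewise W V)) * F (Λ.piecewise W V))
      = fun W => Real.exp (b V) * (F (Λ.piecewise W V) * Real.exp (a (Λ.piecewise W V))) := by
    funext W; rw [hb, Real.exp_add]; ring
  have e2 : (fun W => Real.exp (a (Λ.piecewise W V) + b (Λ.piecewise W V)) *
      (NF (Λ.piecewise W V) / N1 (Λ.piecewise W V)))
      = fun W => (Real.exp (b V) * (NF V / N1 V)) * Real.exp (a (Λ.piecewise W V)) := by
    funext W; rw [hb, hNFpw, hN1pw, Real.exp_add]; ring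
  rw [e1, e2, integral_const_mul, integral_const_mul, ← hNF, ← hN1]
  field_simp [(hN1pos V).ne']

end FiniteDLR

/-! ### The lattice Yang–Mills kernels: integral formula, Feller property, measurability -/

section Kernel

variable {d N : ℕ} {G : Type*} [Group G] [TopologicalSpace G] [IsTopologicalGroup G]
  [CompactSpace G] [MeasurableSpace G] [BorelSpace G] (ρ : G →* Matrix (Fin N) (Fin N) ℂ)

omit [CompactSpace G] [MeasurableSpace G] [BorelSpace G] in
/-- The boundary Wilson action `S_Λ` is continuous for continuous `ρ`. [folklore] -/
theorem continuous_wilsonBoundaryAction (hρ : Continuous ρ) (Λ : Finset (ZdEdge d)) :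
    Continuous (wilsonBoundaryAction (G := G) ρ Λ) := by
  unfold wilsonBoundaryAction
  exact continuous_finsetSum _ fun p _ => continuous_const.sub (continuous_plaquetteObs ρ hρ _ _ _)

omit [Group G] [IsTopologicalGroup G] [CompactSpace G] [MeasurableSpace G] [BorelSpace G] in
/-- Gluing is jointly continuous in the boundary condition and the inner configuration. [folklore] -/
theorem continuous_glueWith_prod (Λ : Finset (ZdEdge d)) :
    Continuous fun p : LGConfig d G × (↥Λ → G) => glueWith Λ p.2 p.1 := by
  refine continuous_pi fun e => ?_
  by_cases he : e ∈ Λ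
  · simp only [glueWith_apply_mem _ _ _ he]
    exact (continuous_apply _).comp continuous_snd
  · simp only [glueWith_apply_not_mem _ _ _ he]
    exact (continuous_apply e).comp continuous_fst

omit [Group G] [TopologicalSpace G] [IsTopologicalGroup G] [CompactSpace G] [BorelSpace G] in
/-- Gluing is jointly measurable in the boundary condition and the inner configuration. [folklore] -/
theorem measurable_glueWith_prod (Λ : Finset (ZdEdge d)) :
    Measurable fun p : LGConfig d G × (↥Λ → G) => glueWith Λ p.2 p.1 := by
  refine measurable_pi_iff.2 fun e => ?_
  by_cases he : e ∈ Λ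
  · simp only [glueWith_apply_mem _ _ _ he]
    exact (measurable_pi_apply _).comp measurable_snd
  · simp only [glueWith_apply_not_mem _ _ _ he]
    exact (measurable_pi_apply e).comp measurable_fst

variable [SecondCountableTopology G]

/-- **Integral formula for the lattice Yang–Mills kernel**:
`∫ F dγ_Λ(· | η) = (∫ F(ζ η_{Λᶜ}) e^{-β S_Λ(ζ η_{Λᶜ})} dζ) / (∫ e^{-β S_Λ(ζ η_{Λᶜ})} dζ)`, the
`ζ`-integrals being over the product Haar measure on the edges of `Λ` (Georgii 2011, Def. 2.9;
Seiler LNP 159 Ch. 2). [folklore] -/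
theorem integral_ymSpecification (hρ : Continuous ρ) (β : ℝ) (Λ : Finset (ZdEdge d))
    {F : LGConfig d G → ℝ} (hF : Measurable F) (η : LGConfig d G) :
    ∫ U, F U ∂(ymSpecification ρ β Λ η) =
      (∫ ζ, F (glueWith Λ ζ η) * Real.exp (-β * wilsonBoundaryAction ρ Λ (glueWith Λ ζ η))
          ∂(Measure.pi fun _ : ↥Λ => QuantumFieldTheory.haarProbability G)) /
        ∫ ζ, Real.exp (-β * wilsonBoundaryAction ρ Λ (glueWith Λ ζ η))
          ∂(Measure.pi fun _ : ↥Λ => QuantumFieldTheory.haarProbability G) := by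
  have hg : Measurable (glueWith Λ · η) := measurable_glueWith Λ η
  have hw : Continuous fun U : LGConfig d G => Real.exp (-β * wilsonBoundaryAction ρ Λ U) :=
    Real.continuous_exp.comp (continuous_const.mul (continuous_wilsonBoundaryAction ρ hρ Λ))
  unfold ymSpecification
  rw [integral_tilted, integral_map hg.aemeasurable hw.aestronglyMeasurable,
    integral_map hg.aemeasurable]
  · simp only [smul_eq_mul]
    rw [← integral_div]
    refine congrArg _ (funext fun ζ => ?_)
    ring
  · exact ((hw.measurable.div_const _).mul hF).aestronglyMeasurable

/-- The lattice Yang–Mills kernels are probability measures (the normaliser is positive and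
finite since the tilting density is bounded and continuous) (Georgii 2011, Def. 2.9). [folklore] -/
theorem isProbabilityMeasure_ymSpecification (hρ : Continuous ρ) (β : ℝ) (Λ : Finset (ZdEdge d))
    (η : LGConfig d G) : IsProbabilityMeasure (ymSpecification ρ β Λ η) := by
  have hg : Measurable (glueWith Λ · η) := measurable_glueWith Λ η
  have hw : Continuous fun U : LGConfig d G => Real.exp (-β * wilsonBoundaryAction ρ Λ U) :=
    Real.continuous_exp.comp (continuous_const.mul (continuous_wilsonBoundaryAction ρ hρ Λ))
  obtain ⟨C, hC⟩ := exists_bound_of_continuous hw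
  unfold ymSpecification
  have : IsProbabilityMeasure ((Measure.pi fun _ : ↥Λ => QuantumFieldTheory.haarProbability G).map
      (glueWith Λ · η)) := Measure.isProbabilityMeasure_map hg.aemeasurable
  exact isProbabilityMeasure_tilted (integrable_of_bound hw.aestronglyMeasurable hC)

/-- The kernel normaliser `Z_Λ(η) = ∫ e^{-β S_Λ(ζ η_{Λᶜ})} dζ` and, more generally, the
un-normalised kernel integrals `η ↦ ∫ F(ζ η_{Λᶜ}) e^{-β S_Λ(ζ η_{Λᶜ})} dζ` of a bounded
continuous `F`, are continuous in the boundary condition (the integrand is jointly continuous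
and the fibre `G^Λ` is compact). [folklore] -/
theorem continuous_integral_glueWith (hρ : Continuous ρ) (β : ℝ) (Λ : Finset (ZdEdge d))
    {F : LGConfig d G → ℝ} (hF : Continuous F) {C : ℝ} (hC : ∀ U, |F U| ≤ C) :
    Continuous fun η : LGConfig d G =>
      ∫ ζ, F (glueWith Λ ζ η) * Real.exp (-β * wilsonBoundaryAction ρ Λ (glueWith Λ ζ η))
        ∂(Measure.pi fun _ : ↥Λ => QuantumFieldTheory.haarProbability G) := by
  have hw : Continuous fun U : LGConfig d G => Real.exp (-β * wilsonBoundaryAction ρ Λ U) :=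
    Real.continuous_exp.comp (continuous_const.mul (continuous_wilsonBoundaryAction ρ hρ Λ))
  obtain ⟨B, hB⟩ := exists_bound_of_continuous hw
  have hΦ : Continuous fun p : LGConfig d G × (↥Λ → G) =>
      F (glueWith Λ p.2 p.1) * Real.exp (-β * wilsonBoundaryAction ρ Λ (glueWith Λ p.2 p.1)) :=
    (hF.comp (continuous_glueWith_prod Λ)).mul (hw.comp (continuous_glueWith_prod Λ))
  refine continuous_integral_of_bound (fun η => hΦ.comp (Continuous.prodMk_right η))
    (fun ζ => hΦ.comp (Continuous.prodMk_left ζ)) (C := C * B) fun η ζ => ?_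
  rw [abs_mul]
  exact mul_le_mul (hC _) (hB _) (abs_nonneg _) ((abs_nonneg _).trans (hC (glueWith Λ ζ η)))

/-- The kernel normaliser is positive. [folklore] -/
theorem normaliser_pos (hρ : Continuous ρ) (β : ℝ) (Λ : Finset (ZdEdge d)) (η : LGConfig d G) :
    0 < ∫ ζ, Real.exp (-β * wilsonBoundaryAction ρ Λ (glueWith Λ ζ η))
        ∂(Measure.pi fun _ : ↥Λ => QuantumFieldTheory.haarProbability G) := by
  have hw : Continuous fun ζ : ↥Λ → G =>
      Real.exp (-β * wilsonBoundaryAction ρ Λ (glueWith Λ ζ η)) :=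
    Real.continuous_exp.comp (continuous_const.mul
      ((continuous_wilsonBoundaryAction ρ hρ Λ).comp
        ((continuous_glueWith_prod Λ).comp (Continuous.prodMk_right η))))
  obtain ⟨B, hB⟩ := exists_bound_of_continuous hw
  exact integral_exp_pos (integrable_of_bound hw.aestronglyMeasurable hB)

/-- **Feller property** of the lattice Yang–Mills specification: for bounded continuous `F`,
`η ↦ ∫ F dγ_Λ(· | η)` is continuous (Georgii 2011, Def. 4.11 ff.; Friedli–Velenik 2017,
Exercise 6.13 with Lemma 6.28). [folklore] -/
theorem continuous_integral_ymSpecification (hρ : Continuous ρ) (β : ℝ) (Λ : Finset (ZdEdge d))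
    {F : LGConfig d G → ℝ} (hF : Continuous F) {C : ℝ} (hC : ∀ U, |F U| ≤ C) :
    Continuous fun η => ∫ U, F U ∂(ymSpecification ρ β Λ η) := by
  simp only [integral_ymSpecification ρ hρ β Λ hF.measurable]
  refine (continuous_integral_glueWith ρ hρ β Λ hF hC).div ?_ fun η => (normaliser_pos ρ hρ β Λ η).ne'
  have h := continuous_integral_glueWith ρ hρ β Λ (F := fun _ => (1 : ℝ)) continuous_const
    (C := 1) (fun _ => by simp)
  simpa using h

/-- Kernel averages of a function bounded by `C` are bounded by `C`. [folklore] -/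
theorem abs_integral_ymSpecification_le (hρ : Continuous ρ) (β : ℝ) (Λ : Finset (ZdEdge d))
    {F : LGConfig d G → ℝ} {C : ℝ} (hC : ∀ U, |F U| ≤ C) (η : LGConfig d G) :
    |∫ U, F U ∂(ymSpecification ρ β Λ η)| ≤ C := by
  have := isProbabilityMeasure_ymSpecification ρ hρ β Λ η
  have h := norm_integral_le_of_norm_le_const (μ := ymSpecification ρ β Λ η) (f := F) (C := C)
    (ae_of_all _ fun U => by simpa [Real.norm_eq_abs] using hC U)
  simpa [Real.norm_eq_abs] using h

omit [Group G] [TopologicalSpace G] [IsTopologicalGroup G] [CompactSpace G] [MeasurableSpace G]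
  [BorelSpace G] [SecondCountableTopology G] in
/-- Gluing boundary conditions that agree on an edge set `T` gives configurations agreeing on
`T`. [folklore] -/
theorem glueWith_congr_of_eqOn {Λ T : Finset (ZdEdge d)} {η η' : LGConfig d G}
    (h : ∀ e ∈ T, η e = η' e) (ζ : ↥Λ → G) {e : ZdEdge d} (he : e ∈ T) :
    glueWith Λ ζ η e = glueWith Λ ζ η' e := by
  by_cases heΛ : e ∈ Λ
  · simp [glueWith_apply_mem _ _ _ heΛ]
  · simp [glueWith_apply_not_mem _ _ _ heΛ, h e he]

/-- **Quasilocality**: the kernel average of a cylinder observable with support `S₀` is a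
cylinder observable supported on `S₀` together with the edges of the plaquettes touching `Λ`
(the interaction has finite range) (Georgii 2011, (2.15); Friedli–Velenik 2017, Lemma 6.28). [folklore] -/
theorem dependsOn_integral_ymSpecification (hρ : Continuous ρ) (β : ℝ) (Λ : Finset (ZdEdge d))
    {F : LGConfig d G → ℝ} (hF : Measurable F) {S₀ : Finset (ZdEdge d)} (hFS : IsCylinder F S₀) :
    IsCylinder (fun η => ∫ U, F U ∂(ymSpecification ρ β Λ η))
      (S₀ ∪ (plaquettesTouching Λ).biUnion plaquetteEdges) := by
  intro η η' h
  have hT : ∀ e ∈ S₀ ∪ (plaquettesTouching Λ).biUnion plaquetteEdges, η e = η' e :=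
    fun e he => h e (Finset.mem_coe.2 he)
  have hS := isCylinder_wilsonBoundaryAction_holds (G := G) ρ Λ
  have hF' : ∀ ζ : ↥Λ → G, F (glueWith Λ ζ η) = F (glueWith Λ ζ η') := fun ζ =>
    hFS fun e he => glueWith_congr_of_eqOn hT ζ (Finset.mem_union_left _ (Finset.mem_coe.1 he))
  have hS' : ∀ ζ : ↥Λ → G, wilsonBoundaryAction ρ Λ (glueWith Λ ζ η) =
      wilsonBoundaryAction ρ Λ (glueWith Λ ζ η') := fun ζ =>
    hS fun e he => glueWith_congr_of_eqOn hT ζ (Finset.mem_union_right _ (Finset.mem_coe.1 he))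
  simp only [integral_ymSpecification ρ hρ β Λ hF, hF', hS']

/-- **Measurability of the kernels in the boundary condition**: for measurable `A`,
`η ↦ γ_Λ(A | η)` is measurable (indeed `𝓕`-measurable; Georgii 2011, Def. 1.23 (ii)). [folklore] -/
theorem measurable_ymSpecification_apply (hρ : Continuous ρ) (β : ℝ) (Λ : Finset (ZdEdge d))
    {A : Set (LGConfig d G)} (hA : MeasurableSet A) :
    Measurable fun η => ymSpecification ρ β Λ η A := by
  have hw : Continuous fun U : LGConfig d G => Real.exp (-β * wilsonBoundaryAction ρ Λ U) :=
    Real.continuous_exp.comp (continuous_const.mul (continuous_wilsonBoundaryAction ρ hρ Λ))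
  -- the normaliser as a (continuous, hence measurable) function of `η`
  have hZ : Continuous fun η : LGConfig d G =>
      ∫ ζ, Real.exp (-β * wilsonBoundaryAction ρ Λ (glueWith Λ ζ η))
        ∂(Measure.pi fun _ : ↥Λ => QuantumFieldTheory.haarProbability G) := by
    have h := continuous_integral_glueWith ρ hρ β Λ (F := fun _ => (1 : ℝ)) continuous_const
      (C := 1) (fun _ => by simp)
    simpa using h
  -- explicit formula for `γ_Λ(A | η)`
  let Φ : LGConfig d G × (↥Λ → G) → ENNReal := fun p =>
    ((fun p : LGConfig d G × (↥Λ → G) => glueWith Λ p.2 p.1) ⁻¹' A).indicator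
      (fun p => ENNReal.ofReal (Real.exp (-β * wilsonBoundaryAction ρ Λ (glueWith Λ p.2 p.1)) /
        ∫ ζ, Real.exp (-β * wilsonBoundaryAction ρ Λ (glueWith Λ ζ p.1))
          ∂(Measure.pi fun _ : ↥Λ => QuantumFieldTheory.haarProbability G))) p
  have hΦ : Measurable Φ := by
    refine Measurable.indicator ?_ ((measurable_glueWith_prod Λ) hA)
    refine ENNReal.measurable_ofReal.comp ?_
    exact ((hw.measurable.comp (measurable_glueWith_prod Λ))).div (hZ.measurable.comp measurable_fst)
  have hformula : (fun η => ymSpecification ρ β Λ η A) = fun η =>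
      ∫⁻ ζ, Φ (η, ζ) ∂(Measure.pi fun _ : ↥Λ => QuantumFieldTheory.haarProbability G) := by
    funext η
    have hg : Measurable (glueWith Λ · η) := measurable_glueWith Λ η
    simp only [ymSpecification]
    rw [tilted_apply' _ _ hA, integral_map hg.aemeasurable hw.aestronglyMeasurable,
      ← lintegral_indicator hA, lintegral_map ?_ hg]
    · refine lintegral_congr fun ζ => ?_
      classical
      simp only [Φ, Set.indicator_apply, Set.mem_preimage]
    · refine Measurable.indicator ?_ hA
      exact ENNReal.measurable_ofReal.comp (hw.measurable.div_const _)
  rw [hformula]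
  exact hΦ.lintegral_prod_right'

end Kernel


/-! ### Torus Wilson states satisfy the local DLR equations -/

section Bridge

variable {d N : ℕ} {G : Type*} [Group G] [TopologicalSpace G] [IsTopologicalGroup G]
  [CompactSpace G] [MeasurableSpace G] [BorelSpace G] (ρ : G →* Matrix (Fin N) (Fin N) ℂ)

omit [CompactSpace G] [MeasurableSpace G] [BorelSpace G] in
/-- The torus plaquette terms `N - Re tr ρ(V_q)` are continuous for continuous `ρ`. [folklore] -/
theorem continuous_plaquetteTerm (hρ : Continuous ρ) {L : ℕ}
    (q : QuantumFieldTheory.Plaquette d L) :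
    Continuous fun V : QuantumFieldTheory.GaugeConfig d L G =>
      (N : ℝ) - (ρ (QuantumFieldTheory.plaquetteHolonomy V q.1 q.2.1.1 q.2.1.2)).trace.re := by
  have h : Continuous fun V : QuantumFieldTheory.GaugeConfig d L G =>
      QuantumFieldTheory.plaquetteHolonomy V q.1 q.2.1.1 q.2.1.2 := by
    unfold QuantumFieldTheory.plaquetteHolonomy; fun_prop
  exact continuous_const.sub (Complex.continuous_re.comp ((hρ.comp h).matrix_trace))

omit [Group G] [IsTopologicalGroup G] [CompactSpace G] [MeasurableSpace G] [BorelSpace G] in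
/-- The periodic lift `torusLift L` is continuous. [folklore] -/
theorem continuous_torusLift (L : ℕ) : Continuous (torusLift (d := d) (G := G) L) :=
  continuous_pi fun _ => continuous_apply _

variable [SecondCountableTopology G]

/-- The torus Wilson expectation as a weighted product-Haar integral:
`⟨X⟩_{Λ_L, β} = Z⁻¹ ∫ e^{-β S(V)} X(V) ∏ₑ dV_e` (Seiler LNP 159 Ch. 1). [folklore] -/
theorem wilsonExpectation_eq_toReal_mul_integral (hρ : Continuous ρ) (β : ℝ) {L : ℕ} [NeZero L]
    (X : QuantumFieldTheory.GaugeConfig d L G → ℝ) :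
    QuantumFieldTheory.wilsonExpectation ρ β X =
      ((QuantumFieldTheory.partitionFunction (d := d) (L := L) ρ β)⁻¹).toReal *
        ∫ V, Real.exp (-β * QuantumFieldTheory.wilsonAction ρ V) * X V
          ∂(Measure.pi fun _ : QuantumFieldTheory.Edge d L =>
            QuantumFieldTheory.haarProbability G) := by
  have hS : Continuous fun V : QuantumFieldTheory.GaugeConfig d L G =>
      QuantumFieldTheory.wilsonAction ρ V :=
    continuous_finsetSum _ fun q _ => continuous_plaquetteTerm ρ hρ q
  have hmeas : Measurable fun V : QuantumFieldTheory.GaugeConfig d L G =>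
      ENNReal.ofReal (Real.exp (-β * QuantumFieldTheory.wilsonAction ρ V)) :=
    ENNReal.measurable_ofReal.comp
      (Real.continuous_exp.comp (continuous_const.mul hS)).measurable
  unfold QuantumFieldTheory.wilsonExpectation QuantumFieldTheory.wilsonMeasure
    QuantumFieldTheory.wilsonWeight
  rw [integral_smul_measure, integral_withDensity_eq_integral_toReal_smul hmeas
    (ae_of_all _ fun _ => ENNReal.ofReal_lt_top), smul_eq_mul]
  congr 1
  refine congrArg _ (funext fun V => ?_)
  rw [ENNReal.toReal_ofReal (Real.exp_pos _).le, smul_eq_mul]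

/-- **Torus Wilson states satisfy the local DLR equations of `ymSpecification`.** Let `F` be a
bounded continuous cylinder observable on `ℤ^d` with support `S₀`, and let the torus size `L` be
so large that reduction mod `L` is injective on the base points of `Λ ∪ S₀ ∪ ∂Λ` (`∂Λ` = edges of
plaquettes touching `Λ`). Then the torus Wilson state gives the same expectation to `F ∘ torusLift`
and to `(γ_Λ F) ∘ torusLift`: the conditional distribution of the edges in (the image of) `Λ`
given the others is the Wilson kernel, whose plaquettes and boundary edges inject into the torus
(Seiler LNP 159 Ch. 2; Georgii 2011, proof of Thm. 4.17, step (4.18); Friedli–Velenik 2017,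
(6.34) and the remark before Exercise 6.14 on periodic boundary conditions). [folklore] -/
theorem wilsonExpectation_toTorusObservable_eq (hρ : Continuous ρ) (β : ℝ) (Λ : Finset (ZdEdge d))
    {F : LGConfig d G → ℝ} (hF : Continuous F) {C : ℝ} (hC : ∀ U, |F U| ≤ C)
    {S₀ : Finset (ZdEdge d)} (hFS : IsCylinder F S₀) {L : ℕ} [NeZero L]
    (hL : Set.InjOn (Torus.proj L)
      ((Λ ∪ S₀ ∪ (plaquettesTouching Λ).biUnion plaquetteEdges).image Prod.fst : Set (Site d))) :
    QuantumFieldTheory.wilsonExpectation ρ β (toTorusObservable L F) =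
      QuantumFieldTheory.wilsonExpectation ρ β
        (toTorusObservable L fun η => ∫ U, F U ∂(ymSpecification ρ β Λ η)) := by
  classical
  -- the relevant finite edge set `T` and the injectivity consequences of `hL`
  have hΛT : Λ ⊆ Λ ∪ S₀ ∪ (plaquettesTouching Λ).biUnion plaquetteEdges :=
    (subset_union_left).trans subset_union_left
  have hS₀T : S₀ ⊆ Λ ∪ S₀ ∪ (plaquettesTouching Λ).biUnion plaquetteEdges :=
    (subset_union_right).trans subset_union_left
  have hPT : (plaquettesTouching Λ).biUnion plaquetteEdges ⊆
      Λ ∪ S₀ ∪ (plaquettesTouching Λ).biUnion plaquetteEdges := subset_union_right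
  have hTinj := injOn_torusEdge hL
  have hPinj := injOn_projPlaquette (image_subset_image hPT) hL
  -- near and far parts of the torus action
  set a : QuantumFieldTheory.GaugeConfig d L G → ℝ := fun V =>
    -β * ∑ q ∈ (plaquettesTouching Λ).image
        (fun p : ZdPlaquette d => ((Torus.proj L p.1, p.2) : QuantumFieldTheory.Plaquette d L)),
      ((N : ℝ) - (ρ (QuantumFieldTheory.plaquetteHolonomy V q.1 q.2.1.1 q.2.1.2)).trace.re)
    with ha_def
  set b : QuantumFieldTheory.GaugeConfig d L G → ℝ := fun V =>
    -β * ∑ q ∈ ((plaquettesTouching Λ).image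
        (fun p : ZdPlaquette d => ((Torus.proj L p.1, p.2) : QuantumFieldTheory.Plaquette d L)))ᶜ,
      ((N : ℝ) - (ρ (QuantumFieldTheory.plaquetteHolonomy V q.1 q.2.1.1 q.2.1.2)).trace.re)
    with hb_def
  have hab : ∀ V, -β * QuantumFieldTheory.wilsonAction ρ V = a V + b V := fun V => by
    simp only [ha_def, hb_def, QuantumFieldTheory.wilsonAction, ← mul_add,
      Finset.sum_add_sum_compl]
  have ha : ∀ V, a V = -β * wilsonBoundaryAction ρ Λ (torusLift L V) := fun V => by
    simp only [ha_def, sum_image_proj_plaquetteTerm ρ hPinj]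
  have hb : ∀ W V, b ((Λ.image (torusEdge L)).piecewise W V) = b V := fun W V => by
    simp only [hb_def]
    congr 1
    refine Finset.sum_congr rfl fun q hq => ?_
    rw [plaquetteHolonomy_piecewise_of_ne (fun p hp h => (Finset.mem_compl.1 hq)
      (Finset.mem_image.2 ⟨p, hp, h⟩)) W V]
  have hac : Continuous a :=
    continuous_const.mul (continuous_finsetSum _ fun q _ => continuous_plaquetteTerm ρ hρ q)
  have hbc : Continuous b :=
    continuous_const.mul (continuous_finsetSum _ fun q _ => continuous_plaquetteTerm ρ hρ q)
  obtain ⟨A, hA⟩ := exists_bound_of_continuous hac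
  obtain ⟨B, hB⟩ := exists_bound_of_continuous hbc
  have hFt : Continuous fun V : QuantumFieldTheory.GaugeConfig d L G => F (torusLift L V) :=
    hF.comp (continuous_torusLift L)
  -- transfer of the fibre integrals from `G^Λ` to the torus
  have hτ : Function.Injective fun e : ↥Λ => torusEdge L (e : ZdEdge d) := fun e₁ e₂ h =>
    Subtype.ext (hTinj (hΛT e₁.2) (hΛT e₂.2) h)
  have transfer : ∀ Φ : LGConfig d G → ℝ, Continuous Φ →
      DependsOn Φ ↑(Λ ∪ S₀ ∪ (plaquettesTouching Λ).biUnion plaquetteEdges) →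
      ∀ V : QuantumFieldTheory.GaugeConfig d L G,
        ∫ ζ, Φ (glueWith Λ ζ (torusLift L V))
            ∂(Measure.pi fun _ : ↥Λ => QuantumFieldTheory.haarProbability G) =
          ∫ W, Φ (torusLift L ((Λ.image (torusEdge L)).piecewise W V))
            ∂(Measure.pi fun _ : QuantumFieldTheory.Edge d L =>
              QuantumFieldTheory.haarProbability G) := by
    intro Φ hΦc hΦT V
    have hm : Measurable fun (W : QuantumFieldTheory.GaugeConfig d L G) (e : ↥Λ) =>
        W (torusEdge L (e : ZdEdge d)) :=
      measurable_pi_iff.2 fun e => measurable_pi_apply _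
    have hc : Continuous fun ζ : ↥Λ → G => Φ (glueWith Λ ζ (torusLift L V)) :=
      hΦc.comp ((continuous_glueWith_prod Λ).comp (Continuous.prodMk_right (torusLift L V)))
    rw [← pi_map_comp_injective (QuantumFieldTheory.haarProbability G) hτ,
      integral_map hm.aemeasurable hc.aestronglyMeasurable]
    refine congrArg _ (funext fun W => hΦT fun e he => ?_)
    exact (torusLift_piecewise_apply hΛT hTinj W V he).symm
  -- locality of the two fibre integrands
  have hST : DependsOn (wilsonBoundaryAction (G := G) ρ Λ)
      ↑(Λ ∪ S₀ ∪ (plaquettesTouching Λ).biUnion plaquetteEdges) :=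
    (isCylinder_wilsonBoundaryAction_holds (G := G) ρ Λ).mono (Finset.coe_subset.2 hPT)
  have hFT : DependsOn F ↑(Λ ∪ S₀ ∪ (plaquettesTouching Λ).biUnion plaquetteEdges) :=
    hFS.mono (Finset.coe_subset.2 hS₀T)
  have hw : Continuous fun U : LGConfig d G => Real.exp (-β * wilsonBoundaryAction ρ Λ U) :=
    Real.continuous_exp.comp (continuous_const.mul (continuous_wilsonBoundaryAction ρ hρ Λ))
  -- the kernel average of `F` at a periodic boundary condition, computed on the torus
  have key : ∀ V : QuantumFieldTheory.GaugeConfig d L G,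
      ∫ U, F U ∂(ymSpecification ρ β Λ (torusLift L V)) =
        (∫ W, F (torusLift L ((Λ.image (torusEdge L)).piecewise W V)) *
            Real.exp (a ((Λ.image (torusEdge L)).piecewise W V))
            ∂(Measure.pi fun _ : QuantumFieldTheory.Edge d L =>
              QuantumFieldTheory.haarProbability G)) /
          ∫ W, Real.exp (a ((Λ.image (torusEdge L)).piecewise W V))
            ∂(Measure.pi fun _ : QuantumFieldTheory.Edge d L =>
              QuantumFieldTheory.haarProbability G) := by
    intro V
    rw [integral_ymSpecification ρ hρ β Λ hF.measurable,
      transfer (fun U => F U * Real.exp (-β * wilsonBoundaryAction ρ Λ U)) (hF.mul hw)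
        (fun x y h => by simp only [hFT h, hST h]),
      transfer (fun U => Real.exp (-β * wilsonBoundaryAction ρ Λ U)) hw
        (fun x y h => by simp only [hST h])]
    simp only [ha]
  -- conclude with the finite-volume DLR identity on the torus
  rw [wilsonExpectation_eq_toReal_mul_integral ρ hρ β,
    wilsonExpectation_eq_toReal_mul_integral ρ hρ β]
  congr 1
  simp only [toTorusObservable_apply, key, hab]
  exact integral_exp_mul_eq_integral_exp_mul_condAvg (QuantumFieldTheory.haarProbability G)
    (Λ.image (torusEdge L)) (F := fun V => F (torusLift L V))
    (NF := fun V => ∫ W, F (torusLift L ((Λ.image (torusEdge L)).piecewise W V)) *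
      Real.exp (a ((Λ.image (torusEdge L)).piecewise W V))
        ∂(Measure.pi fun _ : QuantumFieldTheory.Edge d L => QuantumFieldTheory.haarProbability G))
    (N1 := fun V => ∫ W, Real.exp (a ((Λ.image (torusEdge L)).piecewise W V))
        ∂(Measure.pi fun _ : QuantumFieldTheory.Edge d L => QuantumFieldTheory.haarProbability G))
    hFt.measurable hac.measurable hbc.measurable (fun V => hC _) hA hB hb (fun V => rfl)
    (fun V => rfl)

end Bridge

/-! ### Assembly: infinite-volume limits of torus states are DLR states -/

section Assembly

/-- Exhaustion of a countable index set by finite sets, in the form needed for cylinder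
approximation: `(T n).piecewise U η₀ → U` coordinatewise-eventually, hence in the product
topology. [folklore] -/
theorem exists_piecewise_tendsto {E : Type*} [Countable E] [DecidableEq E] {S : Type*}
    [TopologicalSpace S] (η₀ : E → S) :
    ∃ T : ℕ → Finset E, ∀ U : E → S, Tendsto (fun n => (T n).piecewise U η₀) atTop (𝓝 U) := by
  obtain ⟨f, hf⟩ := Countable.exists_injective_nat E
  refine ⟨fun n => (Finset.range n).preimage f (hf.injOn), fun U => ?_⟩
  rw [tendsto_pi_nhds]
  intro e
  refine tendsto_const_nhds.congr' ?_
  filter_upwards [eventually_gt_atTop (f e)] with n hn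
  rw [Finset.piecewise_eq_of_mem]
  exact Finset.mem_preimage.2 (Finset.mem_range.2 hn)

variable {d N : ℕ} {G : Type*} [Group G] [TopologicalSpace G] [IsTopologicalGroup G]
  [CompactSpace G] [MeasurableSpace G] [BorelSpace G] (ρ : G →* Matrix (Fin N) (Fin N) ℂ)

/-- **Infinite-volume limits of torus Wilson states are lattice Yang–Mills Gibbs (DLR) states**
— discharge of the named fact `mem_ymGibbsMeasures_of_mem_infiniteVolumeLimitPoints`.

Proof (Georgii 2011, Thm. 4.17; Friedli–Velenik 2017, Thm. 6.26 with Lemma 6.22 and the remark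
on periodic boundary conditions before Exercise 6.14; Seiler LNP 159 Ch. 2): for a bounded
continuous cylinder observable `F`, the torus states satisfy
`⟨F ∘ lift⟩_L = ⟨(γ_Λ F) ∘ lift⟩_L` once `L` is large (`wilsonExpectation_toTorusObservable_eq`),
and `γ_Λ F` is again a bounded continuous cylinder observable (Feller property and finite range,
`continuous_integral_ymSpecification`, `dependsOn_integral_ymSpecification`); passing to the
limit along the subsequence gives `μ(F) = μ(γ_Λ F)`. This identity extends to all bounded
continuous `F` by dominated convergence along cylinder approximations, hence `μ γ_Λ = μ` as
measures (bounded continuous functions separate finite Borel measures on the compact metrisable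
configuration space), which is the DLR equation. [cite: Georgii2011, Thm. 4.17] -/
theorem mem_ymGibbsMeasures_of_mem_infiniteVolumeLimitPoints_holds :
    mem_ymGibbsMeasures_of_mem_infiniteVolumeLimitPoints (d := d) ρ := by
  intro _ _ hρ β μ hμ
  classical
  obtain ⟨L, hLmono, hprob, hlim⟩ := hμ
  refine ⟨hprob, fun Λ A hA => ?_⟩
  have hγprob : ∀ η, IsProbabilityMeasure (ymSpecification ρ β Λ η) :=
    isProbabilityMeasure_ymSpecification ρ hρ β Λ
  -- Step 1: `μ(F) = μ(γ_Λ F)` for bounded continuous cylinder observables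
  have core_cyl : ∀ (F : LGConfig d G → ℝ) (S₀ : Finset (ZdEdge d)), IsCylinder F S₀ →
      Continuous F → ∀ C : ℝ, (∀ U, |F U| ≤ C) →
        ∫ U, F U ∂μ = ∫ η, (∫ U, F U ∂(ymSpecification ρ β Λ η)) ∂μ := by
    intro F S₀ hFS hFc C hC
    have h1 := hlim F S₀ hFS hFc ⟨C, hC⟩
    have h2 := hlim (fun η => ∫ U, F U ∂(ymSpecification ρ β Λ η))
      (S₀ ∪ (plaquettesTouching Λ).biUnion plaquetteEdges)
      (dependsOn_integral_ymSpecification ρ hρ β Λ hFc.measurable hFS)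
      (continuous_integral_ymSpecification ρ hρ β Λ hFc hC)
      ⟨C, abs_integral_ymSpecification_le ρ hρ β Λ hC⟩
    obtain ⟨L₀, hL₀⟩ := exists_injOn_torusProj
      ((Λ ∪ S₀ ∪ (plaquettesTouching Λ).biUnion plaquetteEdges).image Prod.fst)
    have hev : ∀ᶠ k in atTop,
        QuantumFieldTheory.wilsonExpectation (L := L k + 1) ρ β (toTorusObservable (L k + 1) F) =
          QuantumFieldTheory.wilsonExpectation (L := L k + 1) ρ β (toTorusObservable (L k + 1)
            fun η => ∫ U, F U ∂(ymSpecification ρ β Λ η)) := by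
      filter_upwards [eventually_ge_atTop L₀] with k hk
      exact wilsonExpectation_toTorusObservable_eq ρ hρ β Λ hFc hC hFS
        (hL₀ (L k + 1) (Nat.lt_succ_of_le (hk.trans (hLmono.le_apply))))
    exact tendsto_nhds_unique (h1.congr' hev) h2
  -- Step 2: extension to all bounded continuous observables by cylinder approximation
  have core : ∀ F : LGConfig d G → ℝ, Continuous F → ∀ C : ℝ, (∀ U, |F U| ≤ C) →
      ∫ U, F U ∂μ = ∫ η, (∫ U, F U ∂(ymSpecification ρ β Λ η)) ∂μ := by
    intro F hFc C hC
    obtain ⟨T, hT⟩ := exists_piecewise_tendsto (E := ZdEdge d) (1 : LGConfig d G)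
    have hpc : ∀ n, Continuous fun U : LGConfig d G => (T n).piecewise U 1 := fun n =>
      continuous_pi fun e => by
        by_cases he : e ∈ T n
        · simp only [Finset.piecewise_eq_of_mem _ _ _ he]; exact continuous_apply e
        · simp only [Finset.piecewise_eq_of_notMem _ _ _ he]; exact continuous_const
    have hcyl : ∀ n, IsCylinder (fun U => F ((T n).piecewise U 1)) (T n) := fun n U U' h =>
      congrArg F ((T n).piecewise_congr (fun e he => h e (Finset.mem_coe.2 he)) fun _ _ => rfl)
    have hlim_μ : Tendsto (fun n => ∫ U, F ((T n).piecewise U 1) ∂μ) atTop (𝓝 (∫ U, F U ∂μ)) :=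
      tendsto_integral_of_dominated_convergence (fun _ => C)
        (fun n => (hFc.comp (hpc n)).aestronglyMeasurable) (integrable_const C)
        (fun n => ae_of_all _ fun U => by simpa [Real.norm_eq_abs] using hC _)
        (ae_of_all _ fun U => (hFc.tendsto U).comp (hT U))
    have hlim_γ : ∀ η, Tendsto (fun n => ∫ U, F ((T n).piecewise U 1) ∂(ymSpecification ρ β Λ η))
        atTop (𝓝 (∫ U, F U ∂(ymSpecification ρ β Λ η))) := fun η =>
      tendsto_integral_of_dominated_convergence (fun _ => C)
        (fun n => (hFc.comp (hpc n)).aestronglyMeasurable) (integrable_const C)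
        (fun n => ae_of_all _ fun U => by simpa [Real.norm_eq_abs] using hC _)
        (ae_of_all _ fun U => (hFc.tendsto U).comp (hT U))
    have hlim_μγ : Tendsto (fun n => ∫ η, (∫ U, F ((T n).piecewise U 1)
        ∂(ymSpecification ρ β Λ η)) ∂μ) atTop
        (𝓝 (∫ η, (∫ U, F U ∂(ymSpecification ρ β Λ η)) ∂μ)) :=
      tendsto_integral_of_dominated_convergence (fun _ => C)
        (fun n => (continuous_integral_ymSpecification ρ hρ β Λ (hFc.comp (hpc n))
          (fun U => hC _)).aestronglyMeasurable)
        (integrable_const C)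
        (fun n => ae_of_all _ fun η => by
          simpa [Real.norm_eq_abs] using
            abs_integral_ymSpecification_le ρ hρ β Λ (F := fun U => F ((T n).piecewise U 1))
              (fun U => hC _) η)
        (ae_of_all _ hlim_γ)
    have heq : (fun n => ∫ U, F ((T n).piecewise U 1) ∂μ) = fun n =>
        ∫ η, (∫ U, F ((T n).piecewise U 1) ∂(ymSpecification ρ β Λ η)) ∂μ :=
      funext fun n => core_cyl _ (T n) (hcyl n) (hFc.comp (hpc n)) C fun U => hC _
    rw [heq] at hlim_μ
    exact tendsto_nhds_unique hlim_μ hlim_μγ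
  -- Step 3: `μ = μ γ_Λ` as measures, tested on bounded continuous functions
  have hκ : Measurable (ymSpecification ρ β Λ) :=
    Measure.measurable_of_measurable_coe _ fun s hs =>
      measurable_ymSpecification_apply ρ hρ β Λ hs
  have hμeq : μ = μ.bind (ymSpecification ρ β Λ) := by
    refine ext_of_forall_lintegral_eq_of_IsFiniteMeasure fun f => ?_
    have hfm : Measurable fun x => (f x : ENNReal) :=
      measurable_coe_nnreal_ennreal.comp f.continuous.measurable
    rw [Measure.lintegral_bind hκ.aemeasurable hfm.aemeasurable]
    have hfc : Continuous fun x => (f x : ℝ) := NNReal.continuous_coe.comp f.continuous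
    have hfb : ∀ x, |(f x : ℝ)| ≤ nndist f 0 := fun x => by
      rw [abs_of_nonneg (f x).coe_nonneg]
      exact_mod_cast BoundedContinuousFunction.NNReal.upper_bound f x
    have hint : ∀ (m : Measure (LGConfig d G)) [IsFiniteMeasure m],
        ∫⁻ x, (f x : ENNReal) ∂m = ENNReal.ofReal (∫ x, (f x : ℝ) ∂m) := by
      intro m _
      rw [← BoundedContinuousFunction.toReal_lintegral_coe_eq_integral,
        ENNReal.ofReal_toReal (BoundedContinuousFunction.lintegral_lt_top_of_nnreal m f).ne]
    have hpt : (fun η => ∫⁻ x, (f x : ENNReal) ∂(ymSpecification ρ β Λ η)) = fun η =>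
        ENNReal.ofReal (∫ x, (f x : ℝ) ∂(ymSpecification ρ β Λ η)) :=
      funext fun η => hint _
    rw [hint μ, hpt, ← ofReal_integral_eq_lintegral_ofReal]
    · rw [core _ hfc _ hfb]
    · exact integrable_of_bound (continuous_integral_ymSpecification ρ hρ β Λ hfc
        hfb).aestronglyMeasurable (abs_integral_ymSpecification_le ρ hρ β Λ hfb)
    · exact ae_of_all _ fun η => integral_nonneg fun x => (f x).coe_nonneg
  -- Step 4: the DLR equation for `A`
  calc ∫⁻ η, ymSpecification ρ β Λ η A ∂μ = (μ.bind (ymSpecification ρ β Λ)) A :=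
        (Measure.bind_apply hA hκ.aemeasurable).symm
    _ = μ A := by rw [← hμeq]

end Assembly

end Literature.MathematicalPhysics.QuantumLattice
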